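import Summits.CriticalPhenomena.PercolationContinuityZ3.Theorems.Transplant.SkelNegBParamsRootCrossY
import Summits.CriticalPhenomena.PercolationContinuityZ3.Theorems.Transplant.SkelNegBParamsResidualsA
import HarnessLib

/-!
# N1 params, chain of record `NegB`, part RootCrossY-A — the (ζ′) twin of part RootCrossY: the y′-leg's CLEARANCE and REACH at the (ζ′) counts —
# **`KS.hclrY_RA`** (`Ny + 1 ≤ 1000·Kq`, floor `2000·Kq·(RA′+2) ≤ n_L`) and **`KS.hπ3_RA`** (`Ny + 1 ≤ 1000·Kq`, budget `exA`); the sign `σuOf`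
# (`σuOf_cases/σuOf_sign`) and the cross link **`hx₂₃_R`** of part RootCrossY are cell-free and REUSED as they stand (`hx₂₃_R`'s floor
# `2000(RA′+2) ≤ n_L` follows from `nL_floorsA`).  (stmt-g16 2026-08-22; NEG-SCOPE §B.19 (ζ′).)
builds on p205010 (kernel theorem, internal audit signed; external expert review pending) — nothing in this file uses p205010; NOTHING is claimed about
the node `SamePDropOfSkeletonNeg₁` (OPEN).
Lane `prim-bschramm-*`, seat `prim-bschramm-stmt` (gen 16); helper file (`--supports stmt-CriticalPhenomena-4575 --as helper`); ledger HOME/prim-bschramm-stmt/NEG-PARAMS.md.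
[cite: KozmaNitzan2024, §4 p. 28 ((32) at the root), Lemma 11 (p. 22)] [cite: MartineauTassion2017, §3.2, §4.3 Lemma 4.2]
-/

noncomputable section

open scoped Classical

namespace Summit.CriticalPhenomena.PercolationContinuityZ3.Theorems.Transplant

namespace PlanarSkeletonNeg

namespace NegB

open Literature.Probability.Percolation Literature.Probability.LatticeModels SimpleGraph
open SkelConc (Consts)
open Skelφ (shearUnit shearUnit_pos yRunSched yPrmW)
open Skelφ.StepI (DataN)
open TwoAxis.Para (modulus)
open Neg

namespace KS

section Cross

variable (κ : Consts) {V : Type} [DecidableEq V] [Countable V] {G : SimpleGraph V} [G.LocallyFinite] (Φ : PlanarSkeletonNeg G) (t : V)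
  (p : unitInterval) (D : DataN V) (g f mk : ℕ)

/-- **`hclrY`** ((ζ′) twin: `Ny + 1 ≤ 1000·Kq`, `2000·Kq·(RA′+2) ≤ n_L`): every y′-region (transverse range `[bLo k − RA′ − n_L, bHi k + RA′ + n_L]`) lies on the `σu` side of the root beyond abscissa `k`, for the origin
`yY := yYof σu σ' yX`, whenever `σu·σ'·v_L = |v_L|` and `k < σu·yX₀ + n_L`. [folklore] -/
theorem hclrY_RA (hv : |vL κ Φ t p D g f| ≤ (nL κ Φ t p D g f : ℤ)) (hRAn : 2000 * Neg.Kq κ * (RA' κ Φ t p D mk + 2) ≤ nL κ Φ t p D g f)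
    {σu σ' : ℤ} (hσu : σu = 1 ∨ σu = -1) (hσ : σ' = 1 ∨ σ' = -1) (hs : σu * σ' * vL κ Φ t p D g f = |vL κ Φ t p D g f|)
    (yX : Site 2) (hx0 : (D.k : ℤ) < σu * yX 0 + nL κ Φ t p D g f) (qY' Ny : ℕ) (hNy : Ny + 1 ≤ 1000 * Neg.Kq κ) :
    ∀ k ≤ Ny, ∀ b : ℤ, (yPrmW (nL κ Φ t p D g f) (ℓL κ Φ t p D g f) (hL κ Φ t p D g f) (vL κ Φ t p D g f) (RA' κ Φ t p D mk) qY' Ny).bLo k - RA' κ Φ t p D mk - nL κ Φ t p D g f ≤ b →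
      b ≤ (yPrmW (nL κ Φ t p D g f) (ℓL κ Φ t p D g f) (hL κ Φ t p D g f) (vL κ Φ t p D g f) (RA' κ Φ t p D mk) qY' Ny).bHi k + RA' κ Φ t p D mk + nL κ Φ t p D g f →
        (D.k : ℤ) < σu * σ' * b + σu * yYof κ Φ t p D g f σu σ' yX 0 := by
  intro k hk b hb1 hb2
  unfold ChainPara.RunPrm.bLo at hb1
  unfold ChainPara.RunPrm.bHi at hb2
  simp only [Skelφ.yPrmW] at hb1 hb2
  obtain ⟨hv1, hv2⟩ := abs_le.1 hv
  rw [Int.toNat_of_nonneg (by linarith)] at hb1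
  rw [Int.toNat_of_nonneg (by linarith)] at hb2
  have hKq : (1 : ℤ) ≤ (Neg.Kq κ : ℤ) := by exact_mod_cast Neg.one_le_Kq κ
  have hk' : (k : ℤ) ≤ 1000 * (Neg.Kq κ : ℤ) - 1 := by
    have : ((k : ℕ) : ℤ) ≤ Ny := by exact_mod_cast hk
    have : ((Ny : ℕ) : ℤ) + 1 ≤ ((1000 * Neg.Kq κ : ℕ) : ℤ) := by exact_mod_cast hNy
    push_cast at this; linarith
  clear hk hNy
  have hk0 : (0 : ℤ) ≤ k := Nat.cast_nonneg _
  have hR0 : (0 : ℤ) ≤ (RA' κ Φ t p D mk : ℤ) := Nat.cast_nonneg _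
  have hRAn' : 2000 * (Neg.Kq κ : ℤ) * ((RA' κ Φ t p D mk : ℤ) + 2) ≤ (nL κ Φ t p D g f : ℤ) := by exact_mod_cast hRAn
  clear hRAn
  have hQR : (RA' κ Φ t p D mk : ℤ) ≤ (Neg.Kq κ : ℤ) * (RA' κ Φ t p D mk : ℤ) := le_mul_of_one_le_left hR0 hKq
  have hσu2 : σu * σu = 1 := by rcases hσu with rfl | rfl <;> norm_num
  have e0 : σu * yYof κ Φ t p D g f σu σ' yX 0 = σu * yX 0 + 4 * (nL κ Φ t p D g f : ℤ) + σu * σ' * vL κ Φ t p D g f := by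
    unfold yYof Δ0; simp only [Pi.add_apply, Skelφ.pt_zero]; linear_combination (4 * (nL κ Φ t p D g f : ℤ)) * hσu2
  rw [e0, hs]
  have hsv : σu * σ' = 1 ∨ σu * σ' = -1 := by
    rcases hσu with rfl | rfl <;> rcases hσ with rfl | rfl <;> norm_num
  have hkR : (k : ℤ) * (RA' κ Φ t p D mk : ℤ) ≤ (1000 * (Neg.Kq κ : ℤ) - 1) * (RA' κ Φ t p D mk : ℤ) := mul_le_mul_of_nonneg_right hk' hR0
  have hkR0 : (0 : ℤ) ≤ (k : ℤ) * (RA' κ Φ t p D mk : ℤ) := mul_nonneg hk0 hR0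
  rcases hsv with h1 | h1
  · have hvs : σu * σ' * vL κ Φ t p D g f = vL κ Φ t p D g f := by rw [h1, one_mul]
    rw [hvs] at hs
    rw [h1, one_mul]
    have hv0 : 0 ≤ vL κ Φ t p D g f := by rw [hs]; exact abs_nonneg _
    have hkv : (0 : ℤ) ≤ (k : ℤ) * vL κ Φ t p D g f := mul_nonneg hk0 hv0
    rw [← hs]
    linarith
  · have hvs : σu * σ' * vL κ Φ t p D g f = -vL κ Φ t p D g f := by rw [h1]; ring
    rw [hvs] at hs
    rw [h1]
    have hv0 : vL κ Φ t p D g f ≤ 0 := by linarith [abs_nonneg (vL κ Φ t p D g f)]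
    have hkv : (k : ℤ) * vL κ Φ t p D g f ≤ 0 := mul_nonpos_of_nonneg_of_nonpos hk0 hv0
    rw [← hs]
    linarith

/-- **`hπ3`** ((ζ′) twin: `Ny + 1 ≤ 1000·Kq`, budget `exA`): the y′-regions' `ℓ¹` reach is at most `exA`, for any origin with `|yY|₁ ≤ Yb + 55 n_L` (parts RootValsY `yYof_l1`, Residuals `yL_l1`).
[folklore] -/
theorem hπ3_RA (hn : 1 ≤ nL κ Φ t p D g f) (hv : |vL κ Φ t p D g f| ≤ (nL κ Φ t p D g f : ℤ)) (hκ : (hL κ Φ t p D g f).natAbs ≤ 10 * nL κ Φ t p D g f)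
    (hlay : ((nL κ Φ t p D g f + (hL κ Φ t p D g f).natAbs : ℕ) : ℤ) ≤ (nL κ Φ t p D g f : ℤ) * ℓL κ Φ t p D g f + 1)
    (yY : Site 2) (hyY : (yY 0).natAbs + (yY 1).natAbs ≤ Yb κ Φ t p D g f + 55 * nL κ Φ t p D g f) (qY' Ny : ℕ) (hNy : Ny + 1 ≤ 1000 * Neg.Kq κ) :
    ∀ k ≤ Ny, (yY 0).natAbs + (yY 1).natAbs + (((((k + 1 : ℕ) : ℤ) * vL κ Φ t p D g f).natAbs +
      (((shearUnit (nL κ Φ t p D g f) (hL κ Φ t p D g f) : ℤ) * |((k + 1 : ℕ) : ℤ) * (yPrmW (nL κ Φ t p D g f) (ℓL κ Φ t p D g f) (hL κ Φ t p D g f) (vL κ Φ t p D g f) (RA' κ Φ t p D mk) qY' Ny).sLo| +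
        |hL κ Φ t p D g f| * |((k + 1 : ℕ) : ℤ) * vL κ Φ t p D g f| + shearUnit (nL κ Φ t p D g f) (hL κ Φ t p D g f)) / nL κ Φ t p D g f).natAbs + 1)) ≤ exA κ Φ t p D g f := by
  intro k hk
  have hU := shearUnit_pos hn (hL κ Φ t p D g f)
  have hn0 : (0 : ℤ) < nL κ Φ t p D g f := by exact_mod_cast hn
  have hKq : (1 : ℤ) ≤ (Neg.Kq κ : ℤ) := by exact_mod_cast Neg.one_le_Kq κ
  have hk1 : ((k + 1 : ℕ) : ℤ) ≤ 1000 * (Neg.Kq κ : ℤ) := by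
    have : ((k : ℕ) : ℤ) ≤ Ny := by exact_mod_cast hk
    have : ((Ny : ℕ) : ℤ) + 1 ≤ ((1000 * Neg.Kq κ : ℕ) : ℤ) := by exact_mod_cast hNy
    push_cast at this ⊢; linarith
  clear hk hNy
  have hKq0 : (0 : ℤ) ≤ 1000 * (Neg.Kq κ : ℤ) := by linarith
  have hk0 : (0 : ℤ) ≤ ((k + 1 : ℕ) : ℤ) := Nat.cast_nonneg _
  have hκ' : |hL κ Φ t p D g f| ≤ 10 * (nL κ Φ t p D g f : ℤ) := by rw [← Int.natCast_natAbs]; exact_mod_cast hκ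
  have hUe : (shearUnit (nL κ Φ t p D g f) (hL κ Φ t p D g f) : ℤ) = (nL κ Φ t p D g f : ℤ) + |hL κ Φ t p D g f| := by unfold Skelφ.shearUnit; push_cast [Int.natCast_natAbs]; rfl
  have hU11 : (shearUnit (nL κ Φ t p D g f) (hL κ Φ t p D g f) : ℤ) ≤ 11 * (nL κ Φ t p D g f : ℤ) := by rw [hUe]; linarith
  have hlay' : (shearUnit (nL κ Φ t p D g f) (hL κ Φ t p D g f) : ℤ) ≤ (nL κ Φ t p D g f : ℤ) * ℓL κ Φ t p D g f + 1 := by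
    have : ((nL κ Φ t p D g f + (hL κ Φ t p D g f).natAbs : ℕ) : ℤ) = (shearUnit (nL κ Φ t p D g f) (hL κ Φ t p D g f) : ℤ) := by unfold Skelφ.shearUnit; rfl
    rw [← this]; exact hlay
  have hsLo : (yPrmW (nL κ Φ t p D g f) (ℓL κ Φ t p D g f) (hL κ Φ t p D g f) (vL κ Φ t p D g f) (RA' κ Φ t p D mk) qY' Ny).sLo = sLoY κ Φ t p D g f := rfl
  rw [hsLo]
  have sL' : (shearUnit (nL κ Φ t p D g f) (hL κ Φ t p D g f) : ℤ) * sLoY κ Φ t p D g f ≤ (nL κ Φ t p D g f : ℤ) * ℓL κ Φ t p D g f - (shearUnit (nL κ Φ t p D g f) (hL κ Φ t p D g f) : ℤ) + 1 := by unfold sLoY; exact Int.mul_ediv_self_le hU.ne'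
  have hs0 : 0 ≤ sLoY κ Φ t p D g f := by unfold sLoY; exact Int.ediv_nonneg (by linarith) hU.le
  generalize ((k + 1 : ℕ) : ℤ) = K at hk1 hk0 ⊢
  have a1 : |K * vL κ Φ t p D g f| ≤ 1000 * (Neg.Kq κ : ℤ) * (nL κ Φ t p D g f : ℤ) := by
    rw [abs_mul, abs_of_nonneg hk0]; exact mul_le_mul hk1 hv (abs_nonneg _) hKq0
  have a2 : (shearUnit (nL κ Φ t p D g f) (hL κ Φ t p D g f) : ℤ) * |K * sLoY κ Φ t p D g f| ≤ 1000 * (Neg.Kq κ : ℤ) * ((nL κ Φ t p D g f : ℤ) * ℓL κ Φ t p D g f) := by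
    rw [abs_of_nonneg (mul_nonneg hk0 hs0)]
    have e : (shearUnit (nL κ Φ t p D g f) (hL κ Φ t p D g f) : ℤ) * (K * sLoY κ Φ t p D g f) = K * ((shearUnit (nL κ Φ t p D g f) (hL κ Φ t p D g f) : ℤ) * sLoY κ Φ t p D g f) := by ring
    rw [e]
    have h1 : K * ((shearUnit (nL κ Φ t p D g f) (hL κ Φ t p D g f) : ℤ) * sLoY κ Φ t p D g f) ≤ K * ((nL κ Φ t p D g f : ℤ) * ℓL κ Φ t p D g f) := mul_le_mul_of_nonneg_left (by linarith) hk0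
    have hnl : (0 : ℤ) ≤ (nL κ Φ t p D g f : ℤ) * ℓL κ Φ t p D g f := by nlinarith
    have h2 : K * ((nL κ Φ t p D g f : ℤ) * ℓL κ Φ t p D g f) ≤ 1000 * (Neg.Kq κ : ℤ) * ((nL κ Φ t p D g f : ℤ) * ℓL κ Φ t p D g f) := mul_le_mul_of_nonneg_right hk1 hnl
    linarith
  have a3 : |hL κ Φ t p D g f| * |K * vL κ Φ t p D g f| ≤ 10 * (nL κ Φ t p D g f : ℤ) * (1000 * (Neg.Kq κ : ℤ) * (nL κ Φ t p D g f : ℤ)) := mul_le_mul hκ' a1 (abs_nonneg _) (by positivity)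
  set Nn := (shearUnit (nL κ Φ t p D g f) (hL κ Φ t p D g f) : ℤ) * |K * sLoY κ Φ t p D g f| + |hL κ Φ t p D g f| * |K * vL κ Φ t p D g f| + (shearUnit (nL κ Φ t p D g f) (hL κ Φ t p D g f) : ℤ) with hNn
  have hNn0 : 0 ≤ Nn := by rw [hNn]; positivity
  have hNn1 : Nn ≤ (nL κ Φ t p D g f : ℤ) * (1000 * (Neg.Kq κ : ℤ) * (ℓL κ Φ t p D g f : ℤ) + 10000 * (Neg.Kq κ : ℤ) * (nL κ Φ t p D g f : ℤ) + 11) := by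
    rw [hNn]
    have e1 : (nL κ Φ t p D g f : ℤ) * (1000 * (Neg.Kq κ : ℤ) * (ℓL κ Φ t p D g f : ℤ) + 10000 * (Neg.Kq κ : ℤ) * (nL κ Φ t p D g f : ℤ) + 11) = 1000 * (Neg.Kq κ : ℤ) * ((nL κ Φ t p D g f : ℤ) * ℓL κ Φ t p D g f) + 10 * (nL κ Φ t p D g f : ℤ) * (1000 * (Neg.Kq κ : ℤ) * (nL κ Φ t p D g f : ℤ)) + 11 * (nL κ Φ t p D g f : ℤ) := by ring
    rw [e1]; linarith
  have hdiv : Nn / (nL κ Φ t p D g f : ℤ) ≤ 1000 * (Neg.Kq κ : ℤ) * (ℓL κ Φ t p D g f : ℤ) + 10000 * (Neg.Kq κ : ℤ) * (nL κ Φ t p D g f : ℤ) + 11 := by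
    have := Int.ediv_le_ediv hn0 hNn1
    rwa [Int.mul_ediv_cancel_left _ hn0.ne'] at this
  have hdiv0 : 0 ≤ Nn / (nL κ Φ t p D g f : ℤ) := Int.ediv_nonneg hNn0 hn0.le
  have hex := (exR_le_exR2 κ Φ t p D g f).2
  have hexA : ((exR2 κ Φ t p D g f : ℕ) : ℤ) + (Neg.Kq κ : ℤ) * ((Yb κ Φ t p D g f : ℤ) + 1000 * (shearUnit (nL κ Φ t p D g f) (hL κ Φ t p D g f) : ℤ) + 11055 * (nL κ Φ t p D g f : ℤ) + 1000 * (ℓL κ Φ t p D g f : ℤ) + 20) ≤ (exA κ Φ t p D g f : ℤ) := by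
    have e : exA κ Φ t p D g f = exR2 κ Φ t p D g f + Neg.Kq κ * (Yb κ Φ t p D g f + 1000 * shearUnit (nL κ Φ t p D g f) (hL κ Φ t p D g f) + 11055 * nL κ Φ t p D g f + 1000 * ℓL κ Φ t p D g f + 20) + exCA κ Φ t p D g f := rfl
    have h0 : ((exR2 κ Φ t p D g f + Neg.Kq κ * (Yb κ Φ t p D g f + 1000 * shearUnit (nL κ Φ t p D g f) (hL κ Φ t p D g f) + 11055 * nL κ Φ t p D g f + 1000 * ℓL κ Φ t p D g f + 20) : ℕ) : ℤ) ≤ (exA κ Φ t p D g f : ℤ) := by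
      rw [e]; push_cast; linarith [Int.natCast_nonneg (exCA κ Φ t p D g f)]
    push_cast at h0; linarith
  have hY0 : (0 : ℤ) ≤ (Yb κ Φ t p D g f : ℤ) := Nat.cast_nonneg _
  have hKY : (0 : ℤ) ≤ (Neg.Kq κ : ℤ) * ((Yb κ Φ t p D g f : ℤ) + 1000 * (shearUnit (nL κ Φ t p D g f) (hL κ Φ t p D g f) : ℤ)) := mul_nonneg (by linarith) (by linarith)
  have hKn : (nL κ Φ t p D g f : ℤ) ≤ (Neg.Kq κ : ℤ) * (nL κ Φ t p D g f : ℤ) := le_mul_of_one_le_left hn0.le hKq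
  have hKℓ : (ℓL κ Φ t p D g f : ℤ) * 0 ≤ (Neg.Kq κ : ℤ) * (ℓL κ Φ t p D g f : ℤ) := by nlinarith [Int.natCast_nonneg (ℓL κ Φ t p D g f)]
  have goalZ : (((yY 0).natAbs + (yY 1).natAbs + ((K * vL κ Φ t p D g f).natAbs + (Nn / (nL κ Φ t p D g f : ℤ)).natAbs + 1) : ℕ) : ℤ) ≤ (exA κ Φ t p D g f : ℤ) := by
    have hy : (((yY 0).natAbs + (yY 1).natAbs : ℕ) : ℤ) ≤ ((Yb κ Φ t p D g f + 55 * nL κ Φ t p D g f : ℕ) : ℤ) := by exact_mod_cast hyY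
    have hex' : ((Yb κ Φ t p D g f + 11055 * nL κ Φ t p D g f + 1000 * ℓL κ Φ t p D g f + 20 : ℕ) : ℤ) ≤ (exR2 κ Φ t p D g f : ℤ) := by exact_mod_cast hex
    push_cast [Int.natCast_natAbs] at hy hex' ⊢
    rw [abs_of_nonneg hdiv0]
    obtain ⟨a11, a12⟩ := abs_le.1 a1
    have : |K * vL κ Φ t p D g f| ≤ 1000 * (Neg.Kq κ : ℤ) * (nL κ Φ t p D g f : ℤ) := a1
    linarith
  exact_mod_cast goalZ

end Cross

end KS

end NegB

end PlanarSkeletonNeg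

end Summit.CriticalPhenomena.PercolationContinuityZ3.Theorems.Transplant

end
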